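import Literature.MathematicalPhysics.QuantumFieldTheory.Balaban1983to89.Setup
import Literature.MathematicalPhysics.QuantumFieldTheory.Balaban1983to89.B12Sect4Statements

/-!
# `Balaban1983to89.B12Carve23Sect4WardHyp` — [Balaban1987RG1] pp. 281–286 (Sect. 4, part 1: (4.1)–(4.22) — the localization
# (4.1) and the exponentially small terms `m < n` ((4.2)–(4.5)), the derivative `δB` (4.6), the Ward–Takahashi identities
# (4.7)–(4.15), the derivatives of `B` (4.16)–(4.18), the sum (4.19)–(4.20), and the bilocal term (4.21)–(4.22) with the
# p. 286 display, two-case sentence and «More generally» remark): P6 CARVING-FAN BLOCK 23 — the block's residual printed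
# sentences in hypothesis form and ONE hypothesis bundle `Hyp` of the section's printed statements BY NAME, keyed to the
# consumer (`stmt-QuantumFields-20543`, K2⁷ `EndpointGivenBR13SepCoPH`, [B12]∕[B13]; also-feeds 20544)

statement-level skeleton of published theorems with citation tags; proofs where landed; nothing here is a claim about the
Yang–Mills mass gap

T. Bałaban, *Renormalization group approach to lattice gauge field theories. I. Generation of effective actions in a small
field approximation and a coupling constant renormalization in four dimensions*, Commun. Math. Phys. **109** (1987) 249–301,
doi:10.1007/bf01215223 `[Balaban1987RG1]` (cell paper "B12" = «[I]» of the later papers; journal page = PDF page + 248).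
STATUS: published, refereed.  PDF held: `paper:balaban1987-cmp109-rg-i-small-field`; pp. 281–286 [PDF 33–38] read by this
seat AS IMAGES (renders `run/shared/lean/pub/pub-balaban/b2b-balaban-ref1/pages/1987-cmp109-rg-I-small-field/…-p033-x2.png`,
`…-p034-x2.png`, 2026-08-28) and on the text layer (`p0033.txt` … `p0038.txt`, line locators below; pp. 283–286 also through the
verbatim quotations of record in `B12Ward414`, `B12Ineq417Flat`, `B12Sect4Statements`).  References of [I] used here: [7] =
[Balaban1985Averaging] (B7), [12] = earlier Higgs papers, [15] = [Balaban1985Variational] (B11).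

CITATION HEADER (lean-in-tree rule).  Cell `lit-balaban` (HOME `run/shared/lean/pub/lit-balaban/`), P6 CARVING FAN
(D-0154 (3b)), block 23 of `carve/BLOCKS-21-30.md` (lead g30, READY 2026-08-28T05:30Z) = `carve/CARVE-LIST.md` § Block 23,
claimed by seat `carve-10` g4 under RULING #8 ∕ the self-running rules of the lead's 07:55:37Z close (`carve/STATUS.md` CLAIM
08:10:09Z): «[B12] pp. 281–286, Sect. 4 part 1: Ward–Takahashi identities and their consequences (4.1)–(4.22) (+ p. 286 unnumbered
display ∕ two-case sentence); 16 SKELETON rows; KEY stmt-QuantumFields-20543, also-feeds 20544; target this file».  Filed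
`--supports stmt-QuantumFields-20543`.  RULES (`carve/CARVE-RULES.md` §2; RULING #9 (2) on standing-smallness binders): IN
TREE = CITE, NEVER RESTATE; residual printed statements in hypothesis form `def …Printed : Prop`; ONE bundle `Hyp`; no
`instance`, no `notation`, 0 `sorry`.

## WHAT THE BLOCK'S PAGES PRINT AND WHERE THE TREE HOLDS IT (cite table — every SKELETON row of the block is IN TREE;
## nothing in this table is restated below)
* p. 281 ll. 2–7 (the last paragraph of Sect. 3: «The remaining terms are irrelevant according to our terminology, i.e. they
  satisfy bounds of the form (0.28) on their domains of analyticity») belongs to block 22; (0.28) is the tree's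
  `LocExpansion.IrrelevantBound` ([Balaban1987RG1] (0.28)–(0.29) p. 258), USED below.
* row B12.Eq4.1 — (4.1) p. 281 (the localization `B = ζ̃_□B + (1 − ζ̃_□)B` in the sum of (3.34), binomial expansion in `m`):
  `B12Localization41.eq41`, `eq41_split_last` (PROVED, multilinear bookkeeping).
* rows B12.Eq4.2-4.3 — (4.2) «𝐄^{(j)}(X, U_j(□₀, exp iB)) = 𝐄^{(j)}(X, exp iξ𝐇_j(□₀, B))» and the identities (4.3) (chain
  rule ∕ Cauchy contours): `B12Repr43.blockIns`, `norm_iteratedFDeriv_comp_le`, `B12Eq43ContourFormula`, `B12Eq43ConcreteChain`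
  (PROVED over an abstract complex normed configuration space).
* row B12.Eq4.4 — (4.4) «Thus it is defined and analytic on the space of configurations 𝐀 satisfying max{|𝐀|_X, |P₁(□₀)𝐀|_X,
  |∇^ξ𝐀|_X, |Δ^ξ𝐀|_X} < α₂» and «We have also the bounds (1.18) for this function»: `B12Eq44Space.space44`,
  `analyticOnNhd_E_sub310_one`, `B12Eq44Ball.seminorm44`, `Cfg44`, `analyticOnNhd_E_sub310_one_ball` (the ANALYTICITY ON THE
  (4.4)-BALL PROVED on the model carrier), `B12Decay510FromB11.NormDominated` (the (4.4)-functional dominated by local sizes);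
  (1.18) there is the inductive assumption `LocExpansion.ExpDecayBound` ∕ `B12.RunData.IndAss` (hypothesis `hS` of the kernels).
* p. 282 ll. 2–11 «The functional derivative (δ^{n(p)})∕(δB^{n(p)})𝐇_j(□₀, 0) is given by a sum of several perturbative expressions
  discussed in Sect. G [15]. Each expression corresponds to a tree graph with n(p) initial points and one final point, and it
  has an exponential decay in a length of this graph. … The norm in (4.4) of the expression ⟨…, ⊗_{i∈N(p)} B_i⟩ can be estimated
  by B₃ Π_{i∈N(p)} |B_i|, and if one of the functions B_i is localized outside the domain X, then we have the additional
  exponential factor exp(−δ₀ dist^{(ξ)}(X, supp B_i))»: BY REFERENCE to [15] Sect. G; for the blocks with n(p) = 1 DERIVED in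
  the tree from (190) of [15] (`B12Ineq45.loc_dH_le_of_ineq190_localised`, `B12Decay510FromB11.norm_dH_le`,
  `B12Decay510SectG`); for n(p) ≥ 2 (several localized arguments in one block) NOT typed (cell GAPS G-B11-G2a) — the sentence
  is the hypothesis `hv`∕`hw0`∕`hw1` of `B12Ineq45.term_bound` ∕ `term_bound_pair` and of
  `B12Sect4Statements.differentBlocks_term_le`; its p. 286 special case is `B12Sect4Statements.SameBlockFactor286Printed`.  The
  GENERAL sentence (all n(p)) had no statement-level declaration: typed below (§1, `NormEstimate282Printed`, in exactly the
  binder shape of `term_bound`, with the n(p) = 1 derivation cited).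
* row B12.Eq4.5 — (4.5) p. 282: `B12Ineq45.Ineq45Printed` (typed display over `Data45`; DERIVED modulo named leaves by
  `ineq45_of_repr43` from (4.3) + (4.4) + (1.18) + p. 282 — an iterated Cauchy estimate on a polydisc, `norm_dirIter_le`,
  `term_bound`, `sum_bound_partitions`, `card_finpartitions_le`) — a member of the bundle below BY NAME.
* p. 282 ll. 15–17 «The distance in the second exponential is bounded from below by M(L^jη)⁻¹, hence we get the exponential
  factor exp(−δ₀M(L^jη)⁻¹). This implies that the terms in (4.1) with m < n are irrelevant.» (and p. 281 l. 14 «Terms with m < n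
  are exponentially small in L^jη»): NOT in the tree (`B12Ineq45` header, «WHAT IS NOT HERE: … the words "terms in (4.1) with
  m < n are irrelevant" (the lower bound dist ≥ M(L^jη)⁻¹ and the bookkeeping of (0.28) — cell GAPS G-IF-07 closing note)»):
  typed below (§1, `DistLowerBound282Printed`, `IrrelevantMltN282Printed`).
* p. 282 «We have to consider the terms with m = n only. They are localized in □̃⁴, hence the function ζ̃_□B is defined on the
  unit lattice T₁^{(j)}. We denote it simply by B again, hence B = ζ̃_□Q_j(ηA)»: bookkeeping ∕ notation (no statement).
* row B12.Eq4.6 — (4.6) p. 282 (the t_□-derivative, `δB = ⟨(δ∕δA)Q_j(ηA), η⟨(δ∕δ𝐀)A, ζ_□𝐇_j(B′)⟩⟩`, `A`, `A(𝐀, 𝐁) = (1∕iη) log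
  exp iη𝐀 exp iη𝐁`): `B12Eq46.eq46`, `B12Eq46Frechet` (PROVED); «The fields A and ⟨(δ∕δ𝐀)A, ζ_□𝐇_k(B′)⟩ satisfy the bounds (3.32),
  the second field is localized in
  supp ζ_□, hence δB is localized in □»: (3.32) is block 22's row (`B12Ineq332.ineq332_sup` ∕ `ineq332_grad`, the sizes `b`, `g`
  of `B12Ineq417Flat` ∕ `B12Ineq417DeltaB`, whose object `dQ` carries the `ζ_□` inside `W`); the localization CONCLUSION «δB is
  localized in □» had no statement-level declaration: typed below (§1, `DeltaBLocalized282Printed`).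
* rows B12.Eq4.7-4.9 — (4.7) gauge invariance, (4.8) with «g⁻¹(z) = (−z)∕(e^{−z} − 1) = 1 + ½z + k₂z² + …», (4.9) «holding for
  all 𝔤ᶜ-valued functions λ, and small, 𝔤ᶜ-valued configurations B. It is the fundamental identity expressing the gauge
  invariance of the function 𝐄»: `B12Ward414.pairing`, `fderiv_apply_eq_zero_of_const_along` ((4.7) ⇒ (4.9)), `B12GaugeGen48`
  (the generator and g⁻¹), `B12GaugeInv47`; p. 283 ll. 2–4 «We assume the gauge invariance with respect to Gᶜ-valued gauge
  transformations, but it is implied by the invariance with respect to G-valued transformations, and by the analyticity of the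
  function»: `B12Ward414.fderiv_apply_eq_zero_of_const_along_real` (PROVED).
* rows B12.Eq4.10-4.12, B12.Eq4.11 — (4.10)–(4.12) and «(B₁↔B₂) denotes an expression obtained from the preceding one by the
  exchange of B₁ with B₂»: `B12Ward414.ward_second_order`, `hessian_apply_generator_eq_zero_of_generators` (PROVED).
* rows B12.Eq4.13-4.14 — (4.13), «For constant λ … [λ, (δ∕δB)𝐄(1)] = 0 for all λ ∈ 𝔤ᶜ. The group G is semisimple, hence this is
  possible only for the element 0 in the algebra 𝔤ᶜ», (4.14) «(δ∕δB)𝐄(1) = 0» and «we can drop the term with n = 1»: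
  `B12Semisimple414.hessian_one_apply_grad_eq`, `B12Ward414.fderiv_apply_generator_eq_zero` (PROVED; the n = 1 term is absent
  from `B12Marginal444.sum420`, which starts at n = 2 as (4.20) prints).
* row B12.Eq4.15 — (4.15) «for an arbitrary gauge function λ, and arbitrary gauge fields B₁, B₂, B₃»:
  `B12GaugeInv47.h415_of_gaugeInvariance` (PROVED).
* rows B12.Eq4.16-4.18 — p. 285: «The operation Q_{j,μ} is translation invariant, i.e., Q_{j,μ}(ηA, x + a) = Q_{j,μ}(ηt_aA, x)»:
  `B12Ineq417Flat.logIter_shiftCfg`, `B7TranslationCovariance.logCovIter_shiftCfg` (PROVED for the concrete averaging); (4.16):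
  `B12Eq416DerivB.eq416`, `dB`, `B12Ineq417Flat.eq416_flat` (PROVED); «the derivative ∂^ξA_λ can be bounded by O(1)L^jη. The same
  remark applies to the derivative ∂^ξζ̃_□» and (4.17) «|(∂_νB_μ)(x)| < O(1)(α₂ + B₃O(1)Mα₀)(L^jη)² < α₁(L^jη)²»:
  `B12Eq416DerivB.norm_dB_le`, `B12Ineq417Flat.ineq417_flat` ∕ `ineq417_flat_scaled` (PROVED at the flat background, constants in
  the DICTIONARY there), `B12Ineq417Regular`, `B12Ineq417General`; (4.18) «|(∂_λ∂_νB_μ)(x)| < α₁(L^jη)^{2+β}, 0 ≦ β ≦ β₀ < 1»: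
  `B12Ineq418Flat` (PROVED at the flat background); «The inequalities (4.17), (4.18) hold for the field δB also»:
  `B12Ineq417DeltaB.ineq417_deltaB_general` ∕ `ineq417_deltaB_flat`, `B12Ineq417Regular.ineq418_deltaB_regular_of_invariant`
  (PROVED halves); «Thus the differentiation increases the power of L^jη by 1»: remark.
* rows B12.Eq4.19-4.20 — (4.19) `𝐄⁽ⁿ⁾`, (4.20): `B12Eq419Kernel`, `B12Marginal444.sum420` (PROVED bookkeeping).
* row B12.Eq4.21-4.22, B12.Disp@286, B12.Txt@286a, B12.Txt@286b — (4.21) p. 285, the p. 286 display, the two-case sentence,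
  (4.22) and the «More generally» remark: `B12Sect4Statements.KernelBound422Printed` (decl of record, `kernelBound422_of_terms`),
  `Display286Printed`, `TermEstimate286Printed` (`differentBlocks_term_le`, `termEstimate286_of_pointwise`),
  `SameBlockFactor286Printed` (hypothesis shape, GAPS G-B11-G2a; `sameBlock_product_le` «bounded by δ₀⁻¹»),
  `TreeDecayRemark286Printed` (`B12KernelDecay286.treeDecayRemark286_of_subadditive`), `B12Display286RightMember` — all BY NAME in
  the bundle below; «hence this sum in (4.21) represents an irrelevant term»: the (0.28) bookkeeping, `LocExpansion.IrrelevantBound`.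

## WHAT THIS FILE ADDS
§1 FOUR RESIDUAL PRINTED SENTENCES with no statement-level declaration of record (searched 2026-08-28: `rg` over
`Balaban1983to89/B12*.lean` for the phrases and constants; hits only inside docstrings ∕ as theorem binders, row by row above),
typed in hypothesis form over the carriers the tree's §4 kernels already use (`B12Ineq45.Data45`, the abstract (4.4)-normed
configuration space of `B12Ineq45.term_bound`, `LocExpansion`) or over explicit carriers, each with a kernel-checked
companion: `NormEstimate282Printed` (p. 282 ll. 6–11), `DistLowerBound282Printed` and `IrrelevantMltN282Printed` (p. 282
ll. 15–17 with p. 281 l. 14), `DeltaBLocalized282Printed` (p. 282, after (4.6)).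
§2 THE BUNDLE.  `Carriers E P F` — the parameters the block's printed statements take (plain data, no instances: the (4.4)-normed
configuration space `E`, the points `P` of the p. 286 display and the value group `F` are type PARAMETERS); `Hyp X` — the block's
printed STATEMENTS as hypotheses BY NAME: the §1 sentences and the in-tree typed statements of the range
(`B12Ineq45.Ineq45Printed` (4.5), `B12Sect4Statements.KernelBound422Printed` (4.22), `Display286Printed`, `TermEstimate286Printed`,
`SameBlockFactor286Printed`, `TreeDecayRemark286Printed`); the PROVED rows ((4.1)–(4.3), (4.6)–(4.20)) enter nothing (theorems of
the tree, cited above).  Bookkeeping theorems: `Hyp.ineq45_uniform` (the printed «hence we get the exponential factor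
exp(−δ₀M(L^jη)⁻¹)» out of (4.5) + the distance sentence), `Hyp.term_le` (the p. 282 sentence IS the input of
`B12Ineq45.term_bound`), `Hyp.differentBlocks_summed` (the bundle's p. 286 members are the inputs of
`B12Sect4Statements.differentBlocks_summed_le`), `Hyp.sum_outside_box` (δB localized ⇒ sums over the bonds of □ only).

## HONEST SCOPE
Nothing of [I] is proved here beyond real arithmetic and bookkeeping; the p. 282 block estimate (n(p) ≥ 2, by reference to
[15] Sect. G), the irrelevance of the m < n terms and the localization of δB are NOT proved (hypothesis slots); the residual
sentences are typed in the schematic currency of the existing kernels (abstract normed configuration space, abstract point and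
bond types, reals), not on a lattice carrier — the tree's model theorems cited above are where the located content lives; no
summit statement is proved by this seat; count-neutral; nothing continuum ∕ ℝ⁴ ∕ OS ∕ mass-gap ∕ Clay.  No `sorry`, no
`instance`, no `notation`.
-/

noncomputable section

open Metric Finset
open scoped BigOperators

namespace Literature.MathematicalPhysics.QuantumFieldTheory.Balaban1983to89.B12Carve23Sect4WardHyp

open B12Ineq45 (Data45 Ineq45Printed dirIter)
open B12Sect4Statements (Data422 KernelBound422Printed PointData286 Display286Printed TermEstimate286Printed
  SameBlockFactor286Printed TreeDecayRemark286Printed)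

/-! ## §1  Residual printed sentences of pp. 281–282 (hypothesis form) -/

/-- **p. 282, ll. 6–11 [PDF 34]** (`p0034.txt:L6–L11`, render `…-p034-x2.png`), verbatim: «The norm in (4.4) of the expression
⟨(δ^{n(p)}∕δB^{n(p)})𝐇_j(□₀, 0), ⊗_{i∈N(p)} B_i⟩ can be estimated by B₃ Π_{i∈N(p)} |B_i|, and if one of the functions B_i is
localized outside the domain X, then we have the additional exponential factor exp(−δ₀ dist^{(ξ)}(X, supp B_i)).»  TYPED in
exactly the binder shape in which the tree's (4.3) ⇒ (4.5) kernel consumes it (`B12Ineq45.term_bound`: hypotheses `hv`, `hw0`,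
`hw1`): `E` = the configurations 𝐀 with the (4.4)-norm (`B12Eq44Ball.Cfg44` on the model carrier), `ι` = the arguments `B_i`
with sizes `b i = |B_i|`, `outside i` = «B_i is localized outside the domain X», `distSupp i` = dist^{(ξ)}(X, supp B_i), `N p` =
the blocks of one partition in (4.3), `v p` = the insertion ⟨(δ^{n(p)}∕δB^{n(p)})𝐇_j(□₀, 0), ⊗_{i∈N(p)} B_i⟩ ∈ E; for every block
a localisation weight `w ∈ [0, 1]`, `≤ exp(−δ₀ dist^{(ξ)}(X, supp B_i))` for each outside-localized `B_i` of the block, with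
`‖v p‖ ≤ w · B₃ Π_{i∈N(p)} |B_i|`.  BY REFERENCE to [15] Sect. G in print; the blocks with n(p) = 1 are DERIVED in the tree from
(190) of [15] (`B12Ineq45.loc_dH_le_of_ineq190_localised`, `B12Decay510FromB11.norm_dH_le`); n(p) ≥ 2 is cell GAPS G-B11-G2a.
[cite: Balaban1987RG1, p.282 ll.6–11] -/
def NormEstimate282Printed {ι E : Type*} [SeminormedAddCommGroup E] {r : ℕ} (B₃ δ₀ : ℝ) (b distSupp : ι → ℝ)
    (outside : ι → Prop) (N : Fin r → Finset ι) (v : Fin r → E) : Prop :=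
  ∀ p, ∃ w : ℝ, 0 ≤ w ∧ w ≤ 1 ∧ (∀ i ∈ N p, outside i → w ≤ Real.exp (-(δ₀ * distSupp i))) ∧
    ‖v p‖ ≤ w * (B₃ * ∏ i ∈ N p, b i)

/-- The unweighted half of the p. 282 sentence: every insertion is at most `B₃ Π_{i∈N(p)} |B_i|` (sizes and `B₃` non-negative).
[cite: Balaban1987RG1, p.282 ll.6–11] -/
theorem NormEstimate282Printed.norm_le {ι E : Type*} [SeminormedAddCommGroup E] {r : ℕ} {B₃ δ₀ : ℝ}
    {b distSupp : ι → ℝ} {outside : ι → Prop} {N : Fin r → Finset ι} {v : Fin r → E}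
    (h : NormEstimate282Printed B₃ δ₀ b distSupp outside N v) (hB₃ : 0 ≤ B₃) (hb : ∀ i, 0 ≤ b i) (p : Fin r) :
    ‖v p‖ ≤ B₃ * ∏ i ∈ N p, b i := by
  obtain ⟨w, -, hw1, -, hv⟩ := h p
  have hP : 0 ≤ B₃ * ∏ i ∈ N p, b i := mul_nonneg hB₃ (Finset.prod_nonneg fun i _ => hb i)
  exact hv.trans (by nlinarith)

section TermBound

variable {E : Type*} [NormedAddCommGroup E] [NormedSpace ℂ E]
  {F : Type*} [NormedAddCommGroup F] [NormedSpace ℂ F] [CompleteSpace F]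
  {ι : Type*} [Fintype ι] [DecidableEq ι]

/-- **«Using (4.3) and the last remarks we obtain (4.5)» — one term.**  The p. 282 sentence (as `NormEstimate282Printed`) IS
the input of the tree's kernel `B12Ineq45.term_bound`: with `f` = `𝐀 ↦ 𝐄^{(j)}(X, exp iξ𝐀)` holomorphic on an open `U` containing
the (4.4)-ball of radius `α₂` and `‖f‖ ≤ S` there ((4.4) + (1.18), `S = E₀exp(−κd_j(X))`), one term of (4.3) is at most
`S (2rB₃∕α₂)ʳ exp(−δ₀ dist^{(ξ)}(X, supp B_{i₀})) Π_i |B_i|` for any outside-localized argument `B_{i₀}` (in the block `N p₀`).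
Bookkeeping, by name. [cite: Balaban1987RG1, (4.3)–(4.5) pp.281–282] -/
theorem NormEstimate282Printed.term_le {U : Set E} (hU : IsOpen U) {α₂ S B₃ δ₀ : ℝ} (hα : 0 < α₂)
    (hball : ball (0 : E) α₂ ⊆ U) {f : E → F} (hf : DifferentiableOn ℂ f U) (hS : ∀ y ∈ ball (0 : E) α₂, ‖f y‖ ≤ S)
    (hB₃ : 0 ≤ B₃) {r : ℕ} {N : Fin r → Finset ι} (hdisj : ∀ p q, p ≠ q → Disjoint (N p) (N q))
    (hcov : Finset.univ.biUnion N = Finset.univ) {b distSupp : ι → ℝ} (hb : ∀ i, 0 ≤ b i) {outside : ι → Prop}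
    {v : Fin r → E} (h : NormEstimate282Printed B₃ δ₀ b distSupp outside N v)
    {p₀ : Fin r} {i₀ : ι} (hi₀ : i₀ ∈ N p₀) (hout : outside i₀) :
    ‖dirIter r v f 0‖ ≤ S * (2 * r * B₃ / α₂) ^ r * Real.exp (-(δ₀ * distSupp i₀)) * ∏ i, b i := by
  choose w hw0 hw1 hwout hv using h
  have h1 := B12Ineq45.term_bound hU hα hball hf hS hB₃ N hdisj hcov b hb w hw0 hw1 v hv p₀
  have hS0 : 0 ≤ S := (norm_nonneg _).trans (hS 0 (mem_ball_self hα))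
  have hC : 0 ≤ S * (2 * r * B₃ / α₂) ^ r :=
    mul_nonneg hS0 (pow_nonneg (div_nonneg (by positivity) hα.le) _)
  have hP : 0 ≤ ∏ i, b i := Finset.prod_nonneg fun i _ => hb i
  have h2 : S * (2 * r * B₃ / α₂) ^ r * w p₀ * ∏ i, b i ≤
      S * (2 * r * B₃ / α₂) ^ r * Real.exp (-(δ₀ * distSupp i₀)) * ∏ i, b i :=
    mul_le_mul_of_nonneg_right (mul_le_mul_of_nonneg_left (hwout p₀ i₀ hi₀ hout) hC) hP
  exact h1.trans h2

end TermBound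

/-- **p. 282, ll. 15–16 [PDF 34]** (`p0034.txt:L15–L16`, render `…-p034-x2.png`), verbatim: «The distance in the second
exponential is bounded from below by M(L^jη)⁻¹,» — the second exponential of (4.5), `exp(−δ₀ dist^{(ξ)}(X, supp(1 − ζ̃_□)))`; with
p. 281 l. 14 (`p0033.txt:L14`) «Terms with m < n are exponentially small in L^jη.»  TYPED over explicit reals: `distX` =
dist^{(ξ)}(X, supp(1 − ζ̃_□)) (the field `Data45.distX` of the typed (4.5)), `M` = the cube size, `Ljη` = L^jη.
[cite: Balaban1987RG1, p.282 ll.15–16] -/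
def DistLowerBound282Printed (distX M Ljη : ℝ) : Prop :=
  M * Ljη⁻¹ ≤ distX

/-- «hence we get the exponential factor exp(−δ₀M(L^jη)⁻¹)» (p. 282 l. 16): for δ₀ ≥ 0 the second exponential of (4.5) is at
most `exp(−δ₀M(L^jη)⁻¹)`.  Real arithmetic. [cite: Balaban1987RG1, p.282 ll.15–16] -/
theorem expFactor_le_of_distLowerBound {distX M Ljη δ₀ : ℝ} (h : DistLowerBound282Printed distX M Ljη) (hδ₀ : 0 ≤ δ₀) :
    Real.exp (-(δ₀ * distX)) ≤ Real.exp (-(δ₀ * (M * Ljη⁻¹))) := by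
  apply Real.exp_le_exp.mpr
  have := mul_le_mul_of_nonneg_left h hδ₀
  linarith

/-- **(4.5) made uniform in the term** («Using (4.3) and the last remarks we obtain (4.5). The distance in the second exponential
is bounded from below by M(L^jη)⁻¹, hence we get the exponential factor exp(−δ₀M(L^jη)⁻¹)»): the typed display
`B12Ineq45.Ineq45Printed D` together with the distance sentence gives
`lhs ≤ (2n²B₃∕α₂)ⁿ E₀ e^{−κd_j(X)} · e^{−δ₀M(L^jη)⁻¹} · |ζ̃_□B|^m |(1−ζ̃_□)B|^{n−m}` (signs of the printed constants as hypotheses).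
[cite: Balaban1987RG1, (4.5) p.282 and p.282 ll.15–16] -/
theorem ineq45_uniform_of_distLowerBound (D : Data45) {M Ljη : ℝ} (h45 : Ineq45Printed D)
    (hdist : DistLowerBound282Printed D.distX M Ljη) (hδ₀ : 0 ≤ D.δ₀) (hB₃ : 0 ≤ D.B₃) (hα₂ : 0 < D.α₂) (hE₀ : 0 ≤ D.E₀)
    (hZ : 0 ≤ D.normZB) (hCZ : 0 ≤ D.normCZB) :
    D.lhs ≤ (2 * (D.n : ℝ) ^ 2 * D.B₃ * (1 / D.α₂)) ^ D.n * D.E₀ * Real.exp (-(D.κ * D.djX)) *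
      Real.exp (-(D.δ₀ * (M * Ljη⁻¹))) * (D.normZB ^ D.m * D.normCZB ^ (D.n - D.m)) := by
  have hA : 0 ≤ (2 * (D.n : ℝ) ^ 2 * D.B₃ * (1 / D.α₂)) ^ D.n * D.E₀ * Real.exp (-(D.κ * D.djX)) :=
    mul_nonneg (mul_nonneg (pow_nonneg (by positivity) _) hE₀) (Real.exp_nonneg _)
  have hP : 0 ≤ D.normZB ^ D.m * D.normCZB ^ (D.n - D.m) := mul_nonneg (pow_nonneg hZ _) (pow_nonneg hCZ _)
  have hexp := expFactor_le_of_distLowerBound hdist hδ₀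
  unfold Ineq45Printed at h45
  calc D.lhs ≤ _ := h45
    _ ≤ _ := mul_le_mul_of_nonneg_right (mul_le_mul_of_nonneg_left hexp hA) hP

/-- **p. 282, ll. 16–17 [PDF 34]** (`p0034.txt:L16–L17`), verbatim: «This implies that the terms in (4.1) with m < n are
irrelevant.» — «irrelevant according to our terminology, i.e. they satisfy bounds of the form (0.28) on their domains of
analyticity» (p. 281 ll. 5–7).  TYPED BY NAME as the tree's (0.28)-predicate `LocExpansion.IrrelevantBound` ([Balaban1987RG1]
(0.28)–(0.29) p. 258: `|V(X, φ)| ≤ C(L^jη)^{4+α} exp(−κd_j(X))` on a domain `𝒰`) for the localized expansion `ℰ` = `X ↦` the sum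
of the terms of (4.1) with `m < n`, with the constants `C`, `α`, `κ` and `s = L^jη` as explicit carriers (print: «bounds of the
form (0.28)», constants not displayed). [cite: Balaban1987RG1, p.282 ll.16–17 and p.281 ll.5–7] -/
def IrrelevantMltN282Printed {Φ : Type*} (ℰ : LocExpansion Φ) (𝒰 : Set Φ) (C s α κ : ℝ) : Prop :=
  ℰ.IrrelevantBound 𝒰 C s α κ

/-- Unfolding (definitional): the m < n part of (4.1), localized in X, is bounded by `C(L^jη)^{4+α}e^{−κd_j(X)}` on `𝒰`.
[cite: Balaban1987RG1, p.282 ll.16–17, (0.28) p.258] -/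
theorem irrelevantMltN_iff {Φ : Type*} (ℰ : LocExpansion Φ) (𝒰 : Set Φ) (C s α κ : ℝ) :
    IrrelevantMltN282Printed ℰ 𝒰 C s α κ ↔
      ∀ X φ, φ ∈ 𝒰 → ‖ℰ.E X φ‖ ≤ C * s ^ (4 + α) * Real.exp (-κ * ℰ.sys.dj X) :=
  Iff.rfl

/-- An irrelevant bound with constant `C` is an (0.25)-type exponential bound with constant `C(L^jη)^{4+α}`
(`LocExpansion.ExpDecayBound`, by name) — the sense in which the m < n terms are «very small due to the exponential decay»
(p. 281 l. 10). Bookkeeping. [cite: Balaban1987RG1, p.281 ll.9–14, (0.25)/(0.28) pp.257–258] -/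
theorem IrrelevantMltN282Printed.expDecayBound {Φ : Type*} {ℰ : LocExpansion Φ} {𝒰 : Set Φ} {C s α κ : ℝ}
    (h : IrrelevantMltN282Printed ℰ 𝒰 C s α κ) : ℰ.ExpDecayBound 𝒰 (C * s ^ (4 + α)) κ :=
  fun X φ hφ => h X φ hφ

/-- **p. 282 [PDF 34], after (4.6)** (`p0034.txt:L28–L29`, render `…-p034-x2.png`), verbatim: «The fields A and ⟨(δ∕δ𝐀)A,
ζ_□𝐇_k(B′)⟩ satisfy the bounds (3.32), the second field is localized in supp ζ_□, hence δB is localized in □.»  TYPED — the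
localization conclusion — over explicit carriers: `Bnd` = the bonds of the unit lattice T₁^{(j)}, `inBox b` = «b ⊂ □», `δB` =
the field δB of (4.6) with values in an additive group `V`: δB vanishes off □.  (The (3.32) clause is block 22's row — the sizes
`b`, `g` of `B12Ineq417Flat` ∕ `B12Ineq417DeltaB`, whose object `dQ` carries the `ζ_□` inside its direction `W`.)
[cite: Balaban1987RG1, p.282 (after (4.6))] -/
def DeltaBLocalized282Printed {Bnd V : Type*} [Zero V] (inBox : Bnd → Prop) (δB : Bnd → V) : Prop :=
  ∀ b, ¬ inBox b → δB b = 0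

/-- «hence δB is localized in □»: a bond sum of any expression in δB that vanishes at δB = 0 runs over the bonds of □ only —
the form in which (4.20)–(4.21) sum over `x ∈ □` (finite bond set, decidable box membership). Bookkeeping.
[cite: Balaban1987RG1, p.282 (after (4.6)), (4.21) p.285] -/
theorem DeltaBLocalized282Printed.sum_eq_sum_filter {Bnd V W : Type*} [Fintype Bnd] [Zero V] [AddCommMonoid W]
    {inBox : Bnd → Prop} [DecidablePred inBox] {δB : Bnd → V} (h : DeltaBLocalized282Printed inBox δB)
    (g : Bnd → V → W) (hg : ∀ b, g b 0 = 0) :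
    ∑ b, g b (δB b) = ∑ b ∈ Finset.univ.filter inBox, g b (δB b) := by
  rw [Finset.sum_filter]
  refine Finset.sum_congr rfl fun b _ => ?_
  split_ifs with hb
  · rfl
  · rw [h b hb, hg b]

/-! ## §2  The bundle: the printed statements of pp. 281–286 as hypotheses, by name -/

/-- **Carriers of the block-23 bundle** — plain data over three type PARAMETERS: `E` = the configurations 𝐀 with the (4.4)-norm
(the carrier of `B12Ineq45.term_bound`; on the model `B12Eq44Ball.Cfg44`), `P` = the points `x, x₃` of the unit lattice in □̃⁴
(the carrier of `B12Sect4Statements.PointData286`), `F` = the value group of the partition terms and of the kernels `𝐄⁽ⁿ⁾`.  One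
field per parameter of the block's printed statements: (4.5) — the terms of (4.1) with `m < n` (`T45`) with their printed numbers
`D45 t : B12Ineq45.Data45`; p. 282 — `M`, `Ljη` = L^jη; the arguments `ι` of one term of (4.3) with sizes `b`, support distances
`distSupp`, the outside-X predicate `outside`, the constants `B₃`, `δ₀`, the blocks `N` and insertions `v` of its partition
(`r` blocks); the localized expansion `ℰ41` of the m < n part of (4.1) over configurations `Φ` with its domain `𝒰41` and the
(0.28)-constants `C41`, `α41`, `κ41`; the bonds `Bnd` of T₁^{(j)}, «b ⊂ □» (`inBox`) and `δB`; p. 286 — the display data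
`pd : PointData286 P`, the different-blocks partition terms `termQ` (family `T2`), the same-block tree-graph factors `expFactor`,
the data `D422` of (4.22), and the «More generally» kernel `En` of order `n286` with tree lengths `djXpts`, constant `c286` and
rate `a286`. [cite: Balaban1987RG1, (4.1)–(4.22) pp.281–286] -/
structure Carriers (E P F : Type*) where
  T45 : Type
  D45 : T45 → Data45
  M : ℝ
  Ljη : ℝ
  ι : Type
  b : ι → ℝ
  distSupp : ι → ℝ
  outside : ι → Prop
  B₃ : ℝ
  δ₀ : ℝ
  r : ℕ
  N : Fin r → Finset ι
  v : Fin r → E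
  Φ : Type
  ℰ41 : LocExpansion Φ
  𝒰41 : Set Φ
  C41 : ℝ
  α41 : ℝ
  κ41 : ℝ
  Bnd : Type
  inBox : Bnd → Prop
  δB : Bnd → F
  pd : PointData286 P
  T2 : Type
  termQ : T2 → P → P → F
  expFactor : P → P → ℝ
  D422 : Data422
  n286 : ℕ
  En : (Fin n286 → P) → F
  djXpts : (Fin n286 → P) → ℝ
  c286 : ℝ
  a286 : ℝ

/-- **BLOCK 23 BUNDLE — the printed statements of [Balaban1987RG1] pp. 281–286 AS HYPOTHESES, BY NAME.**  One field per
statement, each a reference to the declaration typing it (nothing restated): `ineq45` — (4.5) p. 282 for every term of (4.1) with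
m < n (`B12Ineq45.Ineq45Printed`); `distLB` — p. 282 «The distance in the second exponential is bounded from below by M(L^jη)⁻¹»
(`DistLowerBound282Printed`, at each term's `distX`); `irrelevant41` — p. 282 «the terms in (4.1) with m < n are irrelevant»
(`IrrelevantMltN282Printed` = `LocExpansion.IrrelevantBound`); `normEst282` — p. 282 «can be estimated by B₃Π_{i∈N(p)}|B_i| … the
additional exponential factor exp(−δ₀dist^{(ξ)}(X, supp B_i))» (`NormEstimate282Printed`); `deltaBloc` — p. 282 «δB is localized in
□» (`DeltaBLocalized282Printed`); `display286` — the p. 286 display (`B12Sect4Statements.Display286Printed`); `termEst286` — p. 286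
«A term corresponding to such a partition can be estimated by …» for every different-blocks term (`TermEstimate286Printed`);
`sameBlock286` — p. 286 «yields the factor exp(−δ₀|x₃ − x|)» (`SameBlockFactor286Printed`); `treeDecay286` — p. 286 «More
generally … exp(−O(1)κd_j(X∪{x₁, …, x_n}))» (`TreeDecayRemark286Printed`); `kernel422` — (4.22) (`KernelBound422Printed`).
Hypothesis slots only; the PROVED rows (4.1)–(4.4), (4.6)–(4.20) are theorems of the tree (module docstring) and enter nothing.
[cite: Balaban1987RG1, (4.5) p.282, p.282, p.286, (4.22) p.286] -/
structure Hyp {E P F : Type*} [SeminormedAddCommGroup E] [Fintype P] [NormedAddCommGroup F] (X : Carriers E P F) :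
    Prop where
  ineq45 : ∀ t : X.T45, Ineq45Printed (X.D45 t)
  distLB : ∀ t : X.T45, DistLowerBound282Printed (X.D45 t).distX X.M X.Ljη
  irrelevant41 : IrrelevantMltN282Printed X.ℰ41 X.𝒰41 X.C41 X.Ljη X.α41 X.κ41
  normEst282 : NormEstimate282Printed X.B₃ X.δ₀ X.b X.distSupp X.outside X.N X.v
  deltaBloc : DeltaBLocalized282Printed X.inBox X.δB
  display286 : Display286Printed X.pd
  termEst286 : ∀ t : X.T2, TermEstimate286Printed X.pd (X.termQ t)
  sameBlock286 : SameBlockFactor286Printed X.pd.δ₀ X.pd.len X.expFactor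
  treeDecay286 : TreeDecayRemark286Printed X.En X.djXpts X.pd.κ X.c286 X.a286
  kernel422 : KernelBound422Printed X.D422

section Consequences

variable {E P F : Type*} [SeminormedAddCommGroup E] [Fintype P] [NormedAddCommGroup F] {X : Carriers E P F}

/-- **(4.5) uniform in the term, out of the bundle**: every term of (4.1) with m < n obeys (4.5) with the second exponential
replaced by `exp(−δ₀M(L^jη)⁻¹)` — the printed «hence we get the exponential factor exp(−δ₀M(L^jη)⁻¹)» (signs of the printed
constants of that term as hypotheses). [cite: Balaban1987RG1, (4.5) p.282 and p.282 ll.15–16] -/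
theorem Hyp.ineq45_uniform (h : Hyp X) (t : X.T45) (hδ₀ : 0 ≤ (X.D45 t).δ₀) (hB₃ : 0 ≤ (X.D45 t).B₃)
    (hα₂ : 0 < (X.D45 t).α₂) (hE₀ : 0 ≤ (X.D45 t).E₀) (hZ : 0 ≤ (X.D45 t).normZB) (hCZ : 0 ≤ (X.D45 t).normCZB) :
    (X.D45 t).lhs ≤ (2 * ((X.D45 t).n : ℝ) ^ 2 * (X.D45 t).B₃ * (1 / (X.D45 t).α₂)) ^ (X.D45 t).n * (X.D45 t).E₀ *
      Real.exp (-((X.D45 t).κ * (X.D45 t).djX)) * Real.exp (-((X.D45 t).δ₀ * (X.M * X.Ljη⁻¹))) *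
      ((X.D45 t).normZB ^ (X.D45 t).m * (X.D45 t).normCZB ^ ((X.D45 t).n - (X.D45 t).m)) :=
  ineq45_uniform_of_distLowerBound (X.D45 t) (h.ineq45 t) (h.distLB t) hδ₀ hB₃ hα₂ hE₀ hZ hCZ

/-- The m < n part of (4.1) satisfies an (0.25)-type bound with constant `C(L^jη)^{4+α}` (out of `irrelevant41`).
[cite: Balaban1987RG1, p.282 ll.16–17, (0.28) p.258] -/
theorem Hyp.expDecay41 (h : Hyp X) : X.ℰ41.ExpDecayBound X.𝒰41 (X.C41 * X.Ljη ^ (4 + X.α41)) X.κ41 :=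
  h.irrelevant41.expDecayBound

/-- Every insertion of the bundled partition is at most `B₃Π|B_i|` (out of `normEst282`, with non-negative sizes and B₃).
[cite: Balaban1987RG1, p.282 ll.6–11] -/
theorem Hyp.insertion_le (h : Hyp X) (hB₃ : 0 ≤ X.B₃) (hb : ∀ i, 0 ≤ X.b i) (p : Fin X.r) :
    ‖X.v p‖ ≤ X.B₃ * ∏ i ∈ X.N p, X.b i :=
  h.normEst282.norm_le hB₃ hb p

/-- Sums of expressions in δB run over the bonds of □ (out of `deltaBloc`). [cite: Balaban1987RG1, p.282 (after (4.6))] -/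
theorem Hyp.sum_outside_box [Fintype X.Bnd] [DecidablePred X.inBox] {W : Type*} [AddCommMonoid W] (h : Hyp X)
    (g : X.Bnd → F → W) (hg : ∀ b, g b 0 = 0) :
    ∑ b, g b (X.δB b) = ∑ b ∈ Finset.univ.filter X.inBox, g b (X.δB b) :=
  h.deltaBloc.sum_eq_sum_filter g hg

/-- **The p. 286 second case out of the bundle**, by the tree's derivation `B12Sect4Statements.differentBlocks_summed_le`: the
printed term estimate (`termEst286`) and the printed display (`display286`) with the lattice-sum constants `c₀(δ₁)`, `c₁(δ₁)` of
(4.22) give, for every different-blocks term, `‖Σ_{x,x₃} termQ x x₃‖ ≤ (8B₃α₁α₂⁻¹)⁴ E₀ c₀ c₁ e^{−⅓κd_j(X)} (L^jη)⁵`. Bookkeeping, by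
name. [cite: Balaban1987RG1, p.286 and (4.22) p.286] -/
theorem Hyp.differentBlocks_summed (h : Hyp X) (t : X.T2) {c₀ c₁ : ℝ} (hE₀ : 0 ≤ X.pd.E₀) (hL : 0 ≤ X.pd.Ljη)
    (hc₁ : 0 ≤ c₁) (hsum0 : ∑ x, Real.exp (-(X.pd.δ₁ * X.pd.dist0 x)) ≤ c₀)
    (hsum1 : ∀ x, ∑ x₃, Real.exp (-(X.pd.δ₁ * X.pd.len x x₃)) * X.pd.len x x₃ ≤ c₁) :
    ‖∑ x, ∑ x₃, X.termQ t x x₃‖ ≤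
      (8 * X.pd.B₃ * (X.pd.α₁ / X.pd.α₂)) ^ 4 * X.pd.E₀ * c₀ * c₁ * Real.exp (-(1 / 3 * X.pd.κ * X.pd.djX)) *
        X.pd.Ljη ^ 5 :=
  B12Sect4Statements.differentBlocks_summed_le X.pd (X.termQ t) (h.termEst286 t) h.display286 hE₀ hL hc₁ hsum0 hsum1

/-- **The p. 286 first case out of the bundle**: a same-block tree-graph factor times the length |x₃ − x| is at most `δ₀⁻¹`
(`sameBlock286` + the tree's `B12Sect4Statements.sameBlock_product_le`, «and the product of it with |x₃ − x| is bounded by δ₀⁻¹»;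
non-negative lengths). [cite: Balaban1987RG1, p.286] -/
theorem Hyp.sameBlock_product (h : Hyp X) (hδ₀ : 0 < X.pd.δ₀) (hlen : ∀ x x₃, 0 ≤ X.pd.len x x₃) (x x₃ : P) :
    X.expFactor x x₃ * X.pd.len x x₃ ≤ X.pd.δ₀⁻¹ :=
  (mul_le_mul_of_nonneg_right (h.sameBlock286 x x₃) (hlen x x₃)).trans
    (B12Sect4Statements.sameBlock_product_le hδ₀ (X.pd.len x x₃))

/-- (4.22) out of the bundle, unfolded by name. [cite: Balaban1987RG1, (4.22) p.286] -/
theorem Hyp.kernelBound422 (h : Hyp X) :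
    X.D422.lhs2 ≤ (32 * X.D422.B₃ * (X.D422.α₁ / X.D422.α₂) * X.D422.c₀ * X.D422.c₁) ^ 4 *
      Real.exp (-(1 / 3 * X.D422.κ * X.D422.djX)) * X.D422.Ljη ^ 5 :=
  h.kernel422

end Consequences

section TermBoundOut

variable {E : Type*} [NormedAddCommGroup E] [NormedSpace ℂ E] {P : Type*} [Fintype P]
  {F : Type*} [NormedAddCommGroup F] [NormedSpace ℂ F] [CompleteSpace F] {X : Carriers E P F}

/-- **One term of (4.3) out of the bundle** (`normEst282` fed to `B12Ineq45.term_bound` via `NormEstimate282Printed.term_le`):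
with `f` = `𝐀 ↦ 𝐄^{(j)}(X, exp iξ𝐀)` holomorphic on an open `U ⊇` the (4.4)-ball of radius `α₂`, `‖f‖ ≤ S` there, a finite
decidable index of arguments and a partition `X.N`, the term is at most `S (2rB₃∕α₂)ʳ e^{−δ₀dist^{(ξ)}(X, supp B_{i₀})} Π|B_i|`
for any outside-localized `B_{i₀}`. Bookkeeping, by name. [cite: Balaban1987RG1, (4.3)–(4.5) pp.281–282] -/
theorem Hyp.term_le [Fintype X.ι] [DecidableEq X.ι] (h : Hyp X) {U : Set E} (hU : IsOpen U) {α₂ S : ℝ} (hα : 0 < α₂)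
    (hball : ball (0 : E) α₂ ⊆ U) {f : E → F} (hf : DifferentiableOn ℂ f U) (hS : ∀ y ∈ ball (0 : E) α₂, ‖f y‖ ≤ S)
    (hB₃ : 0 ≤ X.B₃) (hdisj : ∀ p q, p ≠ q → Disjoint (X.N p) (X.N q))
    (hcov : Finset.univ.biUnion X.N = Finset.univ) (hb : ∀ i, 0 ≤ X.b i) {p₀ : Fin X.r} {i₀ : X.ι}
    (hi₀ : i₀ ∈ X.N p₀) (hout : X.outside i₀) :
    ‖dirIter X.r X.v f 0‖ ≤
      S * (2 * X.r * X.B₃ / α₂) ^ X.r * Real.exp (-(X.δ₀ * X.distSupp i₀)) * ∏ i, X.b i :=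
  h.normEst282.term_le hU hα hball hf hS hB₃ hdisj hcov hb hi₀ hout

end TermBoundOut

end Literature.MathematicalPhysics.QuantumFieldTheory.Balaban1983to89.B12Carve23Sect4WardHyp

end
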